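import Mathlib
import HarnessLib
import Summits.QuantumFields.YangMills.Theses.PencilRigidity
import Summits.QuantumFields.YangMills.Theorems.PencilRigidityCurvatureKernelBoundAxisEnvelopeSymmetry
import Summits.QuantumFields.YangMills.Theorems.PencilRigidityCurvatureKernelBoundAxisEnvelopeGram

/-!
# `CurvatureKernelBound` — stub B `AxisEnvelope`: the time axis is extremal

Closing file for stub `AxisEnvelope` (B) of line `sixteen-charts-analytic-kernel`, crux
`stmt-QuantumFields-11687` (`PencilRigidity.CurvatureKernelBound`).

For a one-species family `𝔖` on `ℝ⁴` with E2 along `e₀` (finite-list form), translation invariance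
on `⁰𝒮` and invariance on `⁰𝒮` under the proper signed permutations, and a kernel `K : ℝ⁴ → ℂ`
continuous off `0` representing `𝔖₂` on `⁰𝒮`, the axis function `k(s) = Re K(s e₀)` controls `K`:

* (a) `K(s e₀)` is real and `≥ 0` for `s > 0`;
* (b) `k` is non-increasing on `(0, ∞)`;
* (c) `‖K x‖ ≤ k(‖x‖ / 2)` for every `x ≠ 0`.

Proof: `…AxisEnvelopeGram.negative_halfspace_control` gives (a), (b) and `‖K ξ‖ ≤ k(-ξ₀)` on the
NEGATIVE half-space/axis (OS Hilbert space: `‖Ψ‖² ≥ 0`, the contraction `e^{-tH}`, Cauchy–Schwarz,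
bumps shrinking to points); evenness `K(-x) = K(x)` (`-1` is a proper signed permutation,
`…AxisEnvelopeSymmetry.kernel_neg`) moves everything to the positive axis; for (c) transport `x`
by a proper signed permutation to `y` with `y₀ = x_μ`, `|x_μ|` maximal (`exists_axis_transport`,
`exists_coord_norm_div_two_le`): `‖K x‖ = ‖K y‖ ≤ k(|y₀|) ≤ k(‖x‖/2)` by (b), as `‖x‖/2 ≤ |x_μ|`.
This is "the time axis is extremal" (Glimm–Jaffe Thm. 6.1.3; Osterwalder–Schrader 1973
(4.6)–(4.9)) at kernel level. [folklore]
-/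

noncomputable section

open scoped BigOperators Topology SchwartzMap ComplexConjugate
open MeasureTheory Filter Set
open Literature.MathematicalPhysics.QuantumLattice Literature.MathematicalPhysics.AQFT
open Literature.MathematicalPhysics.QuantumFieldTheory

namespace Summit.QuantumFields.YangMills.Theorems.CurvatureKernel

/-- **Stub `AxisEnvelope`** (B of line `sixteen-charts-analytic-kernel`, crux
`PencilRigidity.CurvatureKernelBound`; registered signature verbatim): for a reflection-positive,
translation- and proper-hypercubic-invariant one-species family on `ℝ⁴` with a continuous-off-`0`
representing kernel `K`, the axis values `K(s e₀)` (`s > 0`) are real, non-negative and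
non-increasing in `s`, and dominate the kernel: `‖K x‖ ≤ Re K((‖x‖/2) e₀)` for `x ≠ 0`. [folklore] -/
theorem AxisEnvelope : open Literature.MathematicalPhysics.QuantumLattice Literature.MathematicalPhysics.AQFT Literature.MathematicalPhysics.QuantumFieldTheory in ∀ (S₁ : SchwingerFamily (EuclideanSpace ℝ (Fin 4))) (K : (EuclideanSpace ℝ (Fin 4)) → ℂ), S₁.toLabelled.IsReflectionPositive → (∀ (n : ℕ) (a : (EuclideanSpace ℝ (Fin 4))) (F : SchwartzMap (Fin n → (EuclideanSpace ℝ (Fin 4))) ℂ), IsOffDiagonal F → S₁ n (translateMulti a F) = S₁ n F) → (∀ (R : (EuclideanSpace ℝ (Fin 4)) ≃ₗᵢ[ℝ] (EuclideanSpace ℝ (Fin 4))), LinearMap.det (R.toLinearEquiv : (EuclideanSpace ℝ (Fin 4)) →ₗ[ℝ] (EuclideanSpace ℝ (Fin 4))) = 1 → (∀ i : Fin 4, ∃ j : Fin 4, R (EuclideanSpace.single i 1) = EuclideanSpace.single j 1 ∨ R (EuclideanSpace.single i 1) = -EuclideanSpace.single j 1) → ∀ (n : ℕ) (F : SchwartzMap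 (Fin n → (EuclideanSpace ℝ (Fin 4))) ℂ), IsOffDiagonal F → S₁ n (linActMulti R F) = S₁ n F) → ContinuousOn K {x : (EuclideanSpace ℝ (Fin 4)) | x ≠ 0} → (∀ F : SchwartzMap (Fin 2 → (EuclideanSpace ℝ (Fin 4))) ℂ, IsOffDiagonal F → MeasureTheory.Integrable (fun x : Fin 2 → (EuclideanSpace ℝ (Fin 4)) => K (x 0 - x 1) * F x) ∧ S₁ 2 F = ∫ x : Fin 2 → (EuclideanSpace ℝ (Fin 4)), K (x 0 - x 1) * F x) → (∀ s : ℝ, 0 < s → (K (EuclideanSpace.single 0 s)).im = 0 ∧ 0 ≤ (K (EuclideanSpace.single 0 s)).re) ∧ AntitoneOn (fun s : ℝ => (K (EuclideanSpace.single 0 s)).re) (Set.Ioi 0) ∧ (∀ x : (EuclideanSpace ℝ (Fin 4)), x ≠ 0 → ‖K x‖ ≤ (K (EuclideanSpace.single 0 (‖x‖ / 2))).re) := by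
  intro S₁ K hE2 hT hH hK hrep
  obtain ⟨hpos, hmono, hoff⟩ := negative_halfspace_control S₁ K hE2 hT hK hrep
  have heven := kernel_neg S₁ K hK hrep hH
  -- the axis values at `s e₀` and `-s e₀` agree
  have hax : ∀ s : ℝ, 0 < s →
      K (EuclideanSpace.single 0 s) = K (EuclideanSpace.single 0 (-s)) := by
    intro s hs
    have hne : (EuclideanSpace.single 0 (-s) : EuclideanSpace ℝ (Fin 4)) ≠ 0 := by
      intro h0
      have := congrArg (fun v : EuclideanSpace ℝ (Fin 4) => v 0) h0
      simp at this
      linarith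
    have h := heven (EuclideanSpace.single 0 (-s)) hne
    have e : -(EuclideanSpace.single 0 (-s) : EuclideanSpace ℝ (Fin 4)) = EuclideanSpace.single 0 s := by
      ext i; by_cases hi : i = 0 <;> simp [hi]
    rw [e] at h
    exact h
  refine ⟨fun s hs => ?_, ?_, fun x hx => ?_⟩
  · rw [hax s hs]; exact hpos s hs
  · intro s₁ hs₁ s₂ hs₂ h12
    show (K (EuclideanSpace.single 0 s₂)).re ≤ (K (EuclideanSpace.single 0 s₁)).re
    rw [hax s₁ hs₁, hax s₂ hs₂]
    exact hmono s₁ s₂ hs₁ h12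
  · obtain ⟨μ, hμ, hle⟩ := exists_coord_norm_div_two_le x hx
    obtain ⟨y, hy, hy0, -, hKy⟩ := exists_axis_transport S₁ K hK hrep hH μ x hx
    have hy0' : y 0 ≠ 0 := by rw [hy0]; exact hμ
    -- the time-axis bound at `y`
    have hbound : ‖K y‖ ≤ (K (EuclideanSpace.single 0 (-|y 0|))).re := by
      rcases lt_or_gt_of_ne hy0' with hneg | hposy
      · have h1 := hoff y hneg
        have e : y 0 = -|y 0| := by rw [abs_of_neg hneg, neg_neg]
        rw [← e]; exact h1
      · have hny : (-y) 0 < 0 := by rw [PiLp.neg_apply]; linarith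
        have h1 := hoff (-y) hny
        rw [heven y hy, PiLp.neg_apply, ← abs_of_pos hposy] at h1
        exact h1
    have hx2 : 0 < ‖x‖ / 2 := by positivity
    have hle' : ‖x‖ / 2 ≤ |y 0| := by rw [hy0]; exact hle
    have hm := hmono (‖x‖ / 2) |y 0| hx2 hle'
    rw [hax (‖x‖ / 2) hx2, ← hKy]
    exact hbound.trans hm

end Summit.QuantumFields.YangMills.Theorems.CurvatureKernel

end
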